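/-
Copyright (c) 2026 the pub-hodgecm-mathlib formalisation cell (harness21).  Prover seat hodgecm-mathlib-R90-C10-p02 (g2) (R90-TF SLAB, section S1 «Ch. 12 local», surplus hand
on S1's last socket A2′ = the K2E3 leaf (U4f-χ₁-ram-one); dealer of record K2E3-plan (g5)), Track B «K2-LIT» ∕ h413 = `stmt-HodgeConjecture-24833`, line
`K2_E3_EllipticInputs`, unit U4 «Keys», PART «U4Keys» socket :182 (U4f-χ₁-ram-one-pos), programme A_pos^{=} (memo `K2/K2E3-p37/g0/CENSUS-U4f-PosDepth.K2E3-p37-g0.md`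
§6 (A), §10 (c)): the FRAME-FREE LEAF over ★ p863151 (c3)-T ∕ ★ p863059 (c3) — frame recipe of K2E3-p27 (g2) 2026-09-04T21:29:30Z (draft `K2/K2E3-p27/g2/c3/…Leaf.draft.lean`,
credited), typed over the ★ trace-one head per dealer K2E3-plan (g5) ROUND 4e (ii) ∕ 4f (3) («p02's fallback on p27's silence», 23:53Z).  KERNEL module: THEOREMS ONLY.
-/
import Summits.HodgeConjecture.HodgeConjecture.Theorems.K2E3BranchAIrreduciblePosDepthTraceOne  -- ★ p863151 (c3)-T (this seat): `false_of_reducible_of_posDepth_of_normChar_ne_one_of_traceOne` ((G3) frame, trace-one letter); brings ★ p863059 (c3), ★ (a)(b)(c1)(c2), V1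
import Summits.HodgeConjecture.HodgeConjecture.Theorems.K2E3LocalTraceOneLetter              -- ★ p862457 (K2E3-p37 (g2)): the SOURCES of the place-free trace-one letter `hT` (`hunr`, `|2|_{w′} = 1`)
import HarnessLib

/-!
# K2 ∕ E3 «EllipticInputs», unit U4 «Keys» — socket :182 (positive depth), programme A_pos^{=}: BRANCH A OF KEYS' THEOREM AT POSITIVE DEPTH, FRAME-FREE (leaf-shaped)
# «`v` non-split with an integral trace-one element (every unramified `v`; every `v` with `|2|_v = 1`); `χ₁` continuous, non-unitary, contracting, of conductor `≤ m + 1` with a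
#  `σ`-fixed exact-conductor witness of level `m ≥ 1`; `χ₁(u·σu) ≠ 1` for a unit `u` ⟹ `i(χ₁, 1)` is IRREDUCIBLE»   [Keys1984 §3, §7 Thm (2); Roche1998 §3–§4; Casselman1995 §6.4]

Cell hodgecm-mathlib, Track B «K2-LIT», engine E3, crux item H413 = `stmt-HodgeConjecture-24833` (route `HCCMUnconditional`, no route verbs); line `K2_E3_EllipticInputs`,
PART «U4Keys» socket :182 `sig_K2E3KeysThmTwoContractingRamifiedCharOnePosDepth` (Branch A at POSITIVE depth, programme A_pos^{=} of K2E3-p37 (g0)'s memo §6–§10).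
`--supports stmt-HodgeConjecture-24833 --as helper`; THEOREMS ONLY; NOT THE PAYER of :182 (the socket also needs A_pos^{<} (the two-depth (B3) lane), the wildly ramified
dyadic places, Branch B at positive depth (O-182B), and the dealer's :182 re-cut that glues them) — this is the Branch-A sub-case A_pos^{=} in the LEAF's letters.

THE POINT.  ★ p863151 `K2E3BranchAIrreduciblePosDepthTraceOne.false_of_reducible_of_posDepth_of_normChar_ne_one_of_traceOne` (and ★ p863059, its `|2|_w = 1` special case) is
stated in the (G3)-EXPLICIT frame `(w hw eA heA ϖ hϖ g₁ hg₁ K₀ K₁ I hK₀ hK₁ hI g_{m+1} hgn J_{m+1} hJn)` with the letters `w₀` (matrix `Φ₃`), a Haar measure on `N(L⁺_v)` and a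
trace-one `t ∈ L_w`.  THIS FILE (pattern of ★ `K2E3BranchAIrreducibleDepthZeroLeaf`, frame recipe of K2E3-p27 (g2)):
* §1 **`not_reducible_of_posDepth_of_normChar_ne_one_of_traceOne`** — FRAME-FREE over the PLACE-FREE trace-one letter
  `hT : ∃ t : LocalRing L v, t + conjLocal t = 1 ∧ ∀ w′, |t_{w′}| ≤ 1`: at every non-split `v` a place `w ∣ v`, a uniformiser `ϖ`, `g₁ = diag(1,1,ϖ)`, `g_{m+1} = diag(1,1,ϖ^{m+1})`,
  `eA =` ★ `localNonsplitEquiv` on `Φ₃`, `K₀ K₁ I J_{m+1}` by `rfl`, `w₀ = eA⁻¹(w)` (matrix `Φ₃`: ★ `coe_eA_apply`, ★ `StdForm.over_map`), the Haar measure of the closed subgroup `N`,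
  and `t_w` read through ★ `conjLocal_apply_eq_of_smul_eq`; the conductor clauses are spelled PLACE-FREE — `|u_{w′} − 1|_{w′} ≤ exp (−(m+1))` resp. `≤ exp (−m)` for all `w′ ∣ v`
  (`= |ϖ′|^{m+1}`, `|ϖ′|^m` for ANY uniformiser at the one place above `v`, read back through `|ϖ|^k = exp (−k)`); conclusion `¬ ∃ N, N ≠ ⊥ ∧ N ≠ ⊤` in the letters of the leaf.
* §2 the two SOURCED forms (★ p862457): **`…_of_isUnramifiedIn`** (`hunr : Algebra.IsUnramifiedIn (𝓞 L) v.asIdeal` — every inert place, odd AND dyadic; the dealer's LEAF shape,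
  ROUND 4f (3)) and **`not_reducible_of_posDepth_of_normChar_ne_one`** (`h2 : ∀ w′, |2|_{w′} = 1` — every non-dyadic non-split place, incl. tamely ramified).
HONEST LABEL: HC_CM is proved only modulo the 7 printed citations (2 remaining named inputs: hLiu418 = stmt-HodgeConjecture-24832, h413 = stmt-HodgeConjecture-24833) until
rung 0 closes; count-neutral — this file does NOT pay the leaf (A_pos^{=} Branch A only: A_pos^{<}, the wildly ramified dyadic places and Branch B are other files); :182 stays
OPEN; no printed citation is discharged.

## References
* [Keys1984] D. Keys, *Principal series representations of special unitary groups over local fields*, Compositio Math. 51 (1984), §3, §7 Thm (2).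
* [Roche1998] A. Roche, *Types and Hecke algebras for principal series representations of split reductive p-adic groups*, Ann. Sci. ÉNS (4) 31 (1998), §3–§4.
* [Casselman1995] W. Casselman, *Introduction to the theory of admissible representations of `p`-adic reductive groups* (1995), Prop. 1.3.1, §6.3–§6.4.
* [MoyPrasad1996] A. Moy, G. Prasad, *Jacquet functors and unrefined minimal K-types*, Comment. Math. Helv. 71 (1996), §3.
* [BruhatTits1972] F. Bruhat, J. Tits, Publ. Math. IHÉS 41 (1972), (4.4.3)–(4.4.4).
* [Rogawski1990] J. D. Rogawski, *Automorphic Representations of Unitary Groups in Three Variables*, Ann. of Math. Stud. 123 (1990), §1.10 p. 9, §12.2 p. 173.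
* [Serre1979] J.-P. Serre, *Local Fields*, GTM 67 (1979), Ch. III §3 (trace, different; integral elements of trace one at unramified places).
-/

set_option autoImplicit false
-- the mandated namespace has the single-problem summit's repeated segment (`HodgeConjecture.HodgeConjecture`)
set_option linter.dupNamespace false

noncomputable section

open NumberField IsDedekindDomain MeasureTheory
open scoped Matrix MatrixGroups WithZero Valued
open Literature.NumberTheory Literature.NumberTheory.Automorphic Literature.NumberTheory.Automorphic.UnitaryGroup
open Literature.NumberTheory.Rogawski1990

namespace Summit.HodgeConjecture.HodgeConjecture.Cruxes.H413.K2E3BranchAIrreduciblePosDepthLeaf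

open Summit.HodgeConjecture.HodgeConjecture.Cruxes.H413
open Summit.HodgeConjecture.HodgeConjecture.Cruxes.H413.K2E3DepthZeroIwahoriCharacterCM
open Summit.HodgeConjecture.HodgeConjecture.Cruxes.H413.K2E3BranchAIrreduciblePosDepthTraceOne

variable (L : Type) [Field L] [NumberField L] [IsCMField L] (v : HeightOneSpectrum (𝓞 ↥(maximalRealSubfield L))) {m : ℕ}

/-! ## §1 The frame-free leaf over the place-free trace-one letter -/

set_option maxHeartbeats 1600000 in
set_option synthInstance.maxHeartbeats 400000 in
-- ★ p863151 instantiated: the frame, `g_{m+1}`, `J_{m+1}`, `w₀ = eA⁻¹(w)`, the Haar measure of `N`, `t_w` (class of ★ `K2E3BranchAIrreducibleDepthZeroLeaf`)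
/-- **BRANCH A OF KEYS' THEOREM AT POSITIVE DEPTH, frame-free, over the place-free TRACE-ONE letter (sub-case A_pos^{=}).**  `v` non-split (`hns`) carrying an integral
element of trace one (`hT : ∃ t ∈ L ⊗ L⁺_v, t + σt = 1, |t_{w′}| ≤ 1` — every unramified `v`, every `v` with `|2|_v = 1`, ★ p862457); `χ₁ : (L ⊗ L⁺_v)ˣ → ℂˣ` continuous, non-unitary,
contracting, of CONDUCTOR `≤ m + 1` — `χ₁ u = 1` whenever `|u_{w′} − 1|_{w′} ≤ exp (−(m+1))` for all `w′ ∣ v` — with an EXACT-conductor witness `u₁` (`σ u₁ = u₁`, `|(u₁)_{w′} − 1| ≤ exp (−m)`,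
`χ₁ u₁ ≠ 1`), `1 ≤ m`; `u` a unit with `|u_{w′}| = 1` and `χ₁(u · σu) ≠ 1` (Branch A: `χ₁ ∘ N ≠ 1` on `𝒪ˣ`).  Then the principal series `i(χ₁, 1)` of `U(Φ₃)(L⁺_v)` has no `G`-stable
subspace other than `⊥`, `⊤` — ★ p863151 with the frame of ★ `K2E3BranchAIrreducibleDepthZeroLeaf` (a place `w ∣ v`, a uniformiser `ϖ`, `g₁`, `g_{m+1}`, `eA =` ★ `localNonsplitEquiv`,
`K₀ K₁ I J_{m+1}` by `rfl`), `w₀ = eA⁻¹(w)`, the Haar measure on `N`, `|ϖ|^k = exp (−k)` for the conductor clauses, and `t_w + σ_w t_w = 1` read off `hT` at `w` (★ `conjLocal_apply_eq_of_smul_eq`).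
[cite: Keys1984, §3, §7 Thm (2)] [cite: Roche1998, §3–§4] [cite: Casselman1995, §6.3–§6.4] [cite: MoyPrasad1996, §3] [cite: Serre1979, Ch. III §3] -/
theorem not_reducible_of_posDepth_of_normChar_ne_one_of_traceOne
    (hns : ∀ w' : PlacesOver L v, IsCMField.complexConj L • w'.1 = w'.1)
    (χ₁ : (LocalRing L v)ˣ →* ℂˣ) (h₁ : Continuous fun x => ((χ₁ x : ℂˣ) : ℂ)) (hnu : ∃ x, ‖((χ₁ x : ℂˣ) : ℂ)‖ ≠ 1)
    (hcontr : ∀ x : (LocalRing L v)ˣ, unitModulusChar (LocalRing L v) x < 1 → ‖((χ₁ x : ℂˣ) : ℂ)‖ < 1)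
    (hm : 1 ≤ m) (hT : ∃ t : LocalRing L v, t + conjLocal L (IsCMField.complexConj L) v t = 1 ∧ ∀ w' : PlacesOver L v, Valued.v (t w') ≤ 1)
    (hcond : ∀ u : (LocalRing L v)ˣ,
      (∀ w' : PlacesOver L v, Valued.v (((u : LocalRing L v) w') - 1) ≤ WithZero.exp (-((m + 1 : ℕ) : ℤ))) → χ₁ u = 1)
    (u₁ : (LocalRing L v)ˣ) (hσu₁ : Units.map (conjLocal L (IsCMField.complexConj L) v : LocalRing L v →* LocalRing L v) u₁ = u₁)
    (hu₁ : ∀ w' : PlacesOver L v, Valued.v (((u₁ : LocalRing L v) w') - 1) ≤ WithZero.exp (-(m : ℤ))) (hχu₁ : χ₁ u₁ ≠ 1)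
    (u : (LocalRing L v)ˣ) (hu : ∀ w' : PlacesOver L v, Valued.v ((u : LocalRing L v) w') = 1)
    (hA : χ₁ (u * Units.map (conjLocal L (IsCMField.complexConj L) v : LocalRing L v →* LocalRing L v) u) ≠ 1) :
    ¬ ∃ N : Subrepresentation (cmPrincipalSeries L 3 v (cmTorusCharPair L v χ₁ 1)), N ≠ ⊥ ∧ N ≠ ⊤ := by
  classical
  intro hred
  obtain ⟨w⟩ : Nonempty (PlacesOver L v) := inferInstance
  have hw : IsCMField.complexConj L • w.1 = w.1 := hns w
  -- the trace-one letter read at the one place `w`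
  obtain ⟨t, ht, hvt⟩ := hT
  have htw : t w + galAdicCompletionMap (L := L) (IsCMField.complexConj L) hw (t w) = 1 := by
    have h := congrArg (fun x : LocalRing L v => x w) ht
    simp only [Pi.add_apply, Pi.one_apply] at h
    rwa [conjLocal_apply_eq_of_smul_eq (IsCMField.complexConj L) (IsCMField.complexConj_ne_one L) v w hw t] at h
  -- the (G3)-EXPLICIT letters (★ `K2E3BranchAIrreducibleDepthZeroLeaf` pattern): a uniformiser, `g₁`, `g_{m+1}`, `eA =` ★ `localNonsplitEquiv` on `Φ₃`
  obtain ⟨ϖ, hϖ⟩ : ∃ τ : w.1.adicCompletion L, Valued.v τ = WithZero.exp (-1 : ℤ) := by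
    obtain ⟨π, hπ⟩ := w.1.valuation_exists_uniformizer L
    exact ⟨(π : w.1.adicCompletion L), by rw [HeightOneSpectrum.valuedAdicCompletion_eq_valuation', hπ]⟩
  have hϖ0 : ϖ ≠ 0 := fun h0 => by rw [h0, map_zero] at hϖ; exact WithZero.zero_ne_coe hϖ
  -- `|ϖ|^k = exp (−k)`: the place-free conductor clauses in the frame's letters
  have hpow : ∀ k : ℕ, Valued.v ϖ ^ k = WithZero.exp (-(k : ℤ)) := fun k => by
    rw [hϖ, ← WithZero.exp_nsmul]
    simp
  have hcond' : ∀ u' : (LocalRing L v)ˣ, (∀ w' : PlacesOver L v, Valued.v (((u' : LocalRing L v) w') - 1) ≤ Valued.v ϖ ^ (m + 1)) → χ₁ u' = 1 :=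
    fun u' hu' => hcond u' fun w' => by rw [← hpow (m + 1)]; exact hu' w'
  have hu₁' : ∀ w' : PlacesOver L v, Valued.v (((u₁ : LocalRing L v) w') - 1) ≤ Valued.v ϖ ^ m := fun w' => by
    rw [hpow m]; exact hu₁ w'
  obtain ⟨g₁, hg₁⟩ : ∃ g₁ : GL (Fin 3) (w.1.adicCompletion L), (g₁ : Matrix (Fin 3) (Fin 3) (w.1.adicCompletion L)) = Matrix.diagonal ![(1 : w.1.adicCompletion L), 1, ϖ] := by
    refine ⟨glDiagonal 3 (w.1.adicCompletion L) ![1, 1, Units.mk0 ϖ hϖ0], ?_⟩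
    rw [coe_glDiagonal]
    congr 1
    funext i
    fin_cases i <;> rfl
  obtain ⟨gn, hgn⟩ : ∃ gn : GL (Fin 3) (w.1.adicCompletion L),
      (gn : Matrix (Fin 3) (Fin 3) (w.1.adicCompletion L)) = Matrix.diagonal ![(1 : w.1.adicCompletion L), 1, ϖ ^ (m + 1)] := by
    refine ⟨glDiagonal 3 (w.1.adicCompletion L) ![1, 1, Units.mk0 (ϖ ^ (m + 1)) (pow_ne_zero _ hϖ0)], ?_⟩
    rw [coe_glDiagonal]
    congr 1
    funext i
    fin_cases i <;> rfl
  have hJw : placeForm (qsForm L) w.1 = (StdForm.antidiagonal 3).over (w.1.adicCompletion L) := by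
    rw [placeForm, qsForm, antidiagOne_eq_over, StdForm.over_map]
  obtain ⟨eA, heA⟩ : ∃ eA : Gqs L v ≃ₜ* ↥(unitaryGroupOfForm (galAdicCompletionMap (L := L) (IsCMField.complexConj L) hw) ((StdForm.antidiagonal 3).over (w.1.adicCompletion L))),
      ∀ g : Gqs L v, ((eA g : ↥(unitaryGroupOfForm (galAdicCompletionMap (L := L) (IsCMField.complexConj L) hw) ((StdForm.antidiagonal 3).over (w.1.adicCompletion L)))) :
          GL (Fin 3) (w.1.adicCompletion L)) =
        ((localNonsplitEquiv (IsCMField.complexConj L) (qsForm L) (IsCMField.complexConj_ne_one L) w hw g :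
          ↥(unitaryGroupOfForm (galAdicCompletionMap (L := L) (IsCMField.complexConj L) hw) (placeForm (qsForm L) w.1))) : GL (Fin 3) (w.1.adicCompletion L)) := by
    rw [← hJw]
    exact ⟨localNonsplitEquiv (IsCMField.complexConj L) (qsForm L) (IsCMField.complexConj_ne_one L) w hw, fun g => rfl⟩
  -- `w₀ = eA⁻¹(w)` has matrix `Φ₃`
  have hw₀ : Units.val ((eA.symm (weylLongU (galAdicCompletionMap (L := L) (IsCMField.complexConj L) hw)
      (rfl : (StdForm.antidiagonal 3).over (w.1.adicCompletion L) = _))).val : GL (Fin 3) (LocalRing L v)) = cmLocalForm L 3 v := by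
    refine Matrix.ext fun i j => ?_
    rw [LocalRing.eq_iff_apply_eq (IsCMField.complexConj L) (IsCMField.complexConj_ne_one L) w hw,
      ← coe_eA_apply L v w hw eA heA (eA.symm (weylLongU (galAdicCompletionMap (L := L) (IsCMField.complexConj L) hw) rfl)) i j,
      ContinuousMulEquiv.apply_symm_apply, coe_coe_weylLongU, cmLocalForm_eq_over]
    have h := congr_fun (congr_fun ((StdForm.antidiagonal 3).over_map (Pi.evalRingHom (fun w' : PlacesOver L v => w'.1.adicCompletion L) w)) i) j
    rw [Matrix.map_apply, Pi.evalRingHom_apply] at h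
    exact h.symm
  -- the Haar measure of the closed subgroup `N(L⁺_v)`
  letI : MeasurableSpace ↥(cmBorelTriple L 3 v).N := borel _
  haveI : BorelSpace ↥(cmBorelTriple L 3 v).N := ⟨rfl⟩
  haveI : LocallyCompactSpace ↥(unitaryGroupOfForm (conjLocal L (IsCMField.complexConj L) v) (cmLocalForm L 3 v)) :=
    locallyCompactSpace_local (IsCMField.complexConj L) 3 _ v
  haveI : LocallyCompactSpace ↥(cmBorelTriple L 3 v).N :=
    (LineRing.isClosed_unipotentU (conjLocal L (IsCMField.complexConj L) v) (cmLocalForm L 3 v)).isClosedEmbedding_subtypeVal.locallyCompactSpace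
  exact false_of_reducible_of_posDepth_of_normChar_ne_one_of_traceOne L v w hw eA heA hϖ g₁ hg₁ _ _ _ rfl rfl rfl gn hgn _ rfl hns χ₁ h₁ hnu hcontr hm htw (hvt w)
    hcond' u₁ hσu₁ hu₁' hχu₁ u hu hA
    (eA.symm (weylLongU (galAdicCompletionMap (L := L) (IsCMField.complexConj L) hw) (rfl : (StdForm.antidiagonal 3).over (w.1.adicCompletion L) = _)))
    hw₀ Measure.haar hred

/-! ## §2 The sourced forms: unramified places; non-dyadic places -/

/-- **BRANCH A AT POSITIVE DEPTH, frame-free, at an UNRAMIFIED non-split place** (`hunr : v` unramified in `L` — odd or dyadic): §1 with the trace-one letter supplied by ★ p862457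
`exists_traceOne_local_of_isUnramifiedIn_of_nonsplit` (an `a ∈ 𝒪_w` with `|a − σa| = 1` gives `t = a∕(a − σa)`).  The LEAF shape of record for the inert places (dealer K2E3-plan (g5)
ROUND 4f (3)). [cite: Keys1984, §3, §7 Thm (2)] [cite: Roche1998, §3–§4] [cite: Serre1979, Ch. III §3] -/
theorem not_reducible_of_posDepth_of_normChar_ne_one_of_isUnramifiedIn
    (hns : ∀ w' : PlacesOver L v, IsCMField.complexConj L • w'.1 = w'.1) (hunr : Algebra.IsUnramifiedIn (𝓞 L) v.asIdeal)
    (χ₁ : (LocalRing L v)ˣ →* ℂˣ) (h₁ : Continuous fun x => ((χ₁ x : ℂˣ) : ℂ)) (hnu : ∃ x, ‖((χ₁ x : ℂˣ) : ℂ)‖ ≠ 1)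
    (hcontr : ∀ x : (LocalRing L v)ˣ, unitModulusChar (LocalRing L v) x < 1 → ‖((χ₁ x : ℂˣ) : ℂ)‖ < 1)
    (hm : 1 ≤ m)
    (hcond : ∀ u : (LocalRing L v)ˣ,
      (∀ w' : PlacesOver L v, Valued.v (((u : LocalRing L v) w') - 1) ≤ WithZero.exp (-((m + 1 : ℕ) : ℤ))) → χ₁ u = 1)
    (u₁ : (LocalRing L v)ˣ) (hσu₁ : Units.map (conjLocal L (IsCMField.complexConj L) v : LocalRing L v →* LocalRing L v) u₁ = u₁)
    (hu₁ : ∀ w' : PlacesOver L v, Valued.v (((u₁ : LocalRing L v) w') - 1) ≤ WithZero.exp (-(m : ℤ))) (hχu₁ : χ₁ u₁ ≠ 1)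
    (u : (LocalRing L v)ˣ) (hu : ∀ w' : PlacesOver L v, Valued.v ((u : LocalRing L v) w') = 1)
    (hA : χ₁ (u * Units.map (conjLocal L (IsCMField.complexConj L) v : LocalRing L v →* LocalRing L v) u) ≠ 1) :
    ¬ ∃ N : Subrepresentation (cmPrincipalSeries L 3 v (cmTorusCharPair L v χ₁ 1)), N ≠ ⊥ ∧ N ≠ ⊤ :=
  not_reducible_of_posDepth_of_normChar_ne_one_of_traceOne L v hns χ₁ h₁ hnu hcontr hm
    (K2E3LocalTraceOneLetter.exists_traceOne_local_of_isUnramifiedIn_of_nonsplit L v hns hunr) hcond u₁ hσu₁ hu₁ hχu₁ u hu hA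

/-- **BRANCH A AT POSITIVE DEPTH, frame-free, at a NON-DYADIC non-split place** (`|2|_{w′} = 1` for all `w′ ∣ v`, inert or tamely ramified): §1 with `t := 2⁻¹` (★ p862457
`exists_traceOne_local_of_v_two_eq_one_of_nonsplit`) — the `h2`-letter shape of ★ p863059. [cite: Keys1984, §3, §7 Thm (2)] [cite: Roche1998, §3–§4] -/
theorem not_reducible_of_posDepth_of_normChar_ne_one
    (hns : ∀ w' : PlacesOver L v, IsCMField.complexConj L • w'.1 = w'.1) (h2 : ∀ w' : PlacesOver L v, Valued.v (2 : w'.1.adicCompletion L) = 1)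
    (χ₁ : (LocalRing L v)ˣ →* ℂˣ) (h₁ : Continuous fun x => ((χ₁ x : ℂˣ) : ℂ)) (hnu : ∃ x, ‖((χ₁ x : ℂˣ) : ℂ)‖ ≠ 1)
    (hcontr : ∀ x : (LocalRing L v)ˣ, unitModulusChar (LocalRing L v) x < 1 → ‖((χ₁ x : ℂˣ) : ℂ)‖ < 1)
    (hm : 1 ≤ m)
    (hcond : ∀ u : (LocalRing L v)ˣ,
      (∀ w' : PlacesOver L v, Valued.v (((u : LocalRing L v) w') - 1) ≤ WithZero.exp (-((m + 1 : ℕ) : ℤ))) → χ₁ u = 1)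
    (u₁ : (LocalRing L v)ˣ) (hσu₁ : Units.map (conjLocal L (IsCMField.complexConj L) v : LocalRing L v →* LocalRing L v) u₁ = u₁)
    (hu₁ : ∀ w' : PlacesOver L v, Valued.v (((u₁ : LocalRing L v) w') - 1) ≤ WithZero.exp (-(m : ℤ))) (hχu₁ : χ₁ u₁ ≠ 1)
    (u : (LocalRing L v)ˣ) (hu : ∀ w' : PlacesOver L v, Valued.v ((u : LocalRing L v) w') = 1)
    (hA : χ₁ (u * Units.map (conjLocal L (IsCMField.complexConj L) v : LocalRing L v →* LocalRing L v) u) ≠ 1) :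
    ¬ ∃ N : Subrepresentation (cmPrincipalSeries L 3 v (cmTorusCharPair L v χ₁ 1)), N ≠ ⊥ ∧ N ≠ ⊤ :=
  not_reducible_of_posDepth_of_normChar_ne_one_of_traceOne L v hns χ₁ h₁ hnu hcontr hm
    (K2E3LocalTraceOneLetter.exists_traceOne_local_of_v_two_eq_one_of_nonsplit L v hns h2) hcond u₁ hσu₁ hu₁ hχu₁ u hu hA

end Summit.HodgeConjecture.HodgeConjecture.Cruxes.H413.K2E3BranchAIrreduciblePosDepthLeaf

end
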